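import Summits.MatrixMultiplication.OmegaCensus.SmallFormats.MatMul227GF3EnumTables
import Mathlib.Algebra.BigOperators.Intervals
import Mathlib.Algebra.BigOperators.Ring.Finset
import Mathlib.Algebra.Order.BigOperators.Group.LocallyFinite
import Mathlib.Algebra.Order.BigOperators.Group.Finset
import Mathlib.Tactic.Ring
import Mathlib.Tactic.NormNum
import HarnessLib

/-!
# ω-census family (a): kernel `(henum)` at `(7,23)` — the checker

Cell `pub-omega` (unit `pub-omega-tensor`, gen 31), topic `Summits/MatrixMultiplication/OmegaCensus`
(sub-folder `SmallFormats`). Framing (verbatim): lottery ticket; floor = certified bounds/negative ranges.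
HONEST FRAMING: bookkeeping — part 3 of 12 of the KERNEL proof of the ENUMERATION hypothesis `(henum)` of
`twentyfour_le_tensorRank_227_gf3_of_enumeration` (`MatMul22nGF3MarginalCensus`) for the six-orbit list of the
`𝔽₃` `⟨2,2,7⟩@23` X-marginal census (desk-certified ×3 before: ENUM-X2 §6/§8). The EXCLUSION hypothesis `(hexcl)`
stays engine-side (Pa17: two code-disjoint exact engines; the IP instrument); nothing here is a bound on `ω`, and no
sentence here is 'R_𝔽₃(⟨2,2,7⟩) ≥ 24'.

The bounded depth-first CHECKER `chk` over count vectors `c : ℕ → ℕ` on the 40 classes (invertible classes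
first): digit bounds per case, cap pruning on the 82 clause loads, the window `7 ≤ b ≤ 9` with the rank-one ROOM
bound read off the paired J-clauses, and leaf certificates checked by the list action `actW` of words in the five
generators; plus the list plumbing lemmas (`bump`, `leAll`, `cleft`, `roomSum = ∑ room`).
-/

namespace Summit.MatrixMultiplication.OmegaCensus.SmallFormats.Enum723

/-- Cap of clause `k`. -/
def cap (k : ℕ) : ℕ := capL.getD k 0

/-- Incidence `[a ∈ S_k]`. -/
def inc (a k : ℕ) : ℕ := (incL.getD a []).getD k 0

/-- Add `d` copies of an incidence row to a load vector. -/
def bump : List ℕ → List ℕ → ℕ → List ℕ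
  | l :: L, m :: M, d => (l + d * m) :: bump L M d
  | _, _, _ => []

/-- Pointwise `≤` of two lists (on the common prefix). -/
def leAll : List ℕ → List ℕ → Bool
  | l :: L, m :: M => Nat.ble l m && leAll L M
  | _, _ => true

/-- Room of rank-one class `24 + t` under load vector `L` (specification): at most `hiR t`, and at most the
remaining capacity of each of its two J-clauses `2t`, `2t + 1`. -/
def room (hiR L : List ℕ) (t : ℕ) : ℕ :=
  min (hiR.getD t 0) (min (cap (2 * t) - L.getD (2 * t) 0) (cap (2 * t + 1) - L.getD (2 * t + 1) 0))

/-- Pointwise truncated difference `cap − load` (on the common prefix). -/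
def cleft : List ℕ → List ℕ → List ℕ
  | c :: C, l :: L => (c - l) :: cleft C L
  | _, _ => []

/-- The caps of the 32 J-clauses. -/
def capJ : List ℕ := capL.take 32

/-- `∑_t min (H t) (min (C (2t)) (C (2t+1)))`, one linear pass. -/
def roomSumAux : List ℕ → List ℕ → ℕ
  | h :: H, c₁ :: c₂ :: C => min h (min c₁ c₂) + roomSumAux H C
  | _, _ => 0

/-- The rank-one capacity bound at depth `i`: the rooms of the rank-one classes `24 + t` with `i ≤ 24 + t`
(one linear pass over the J-block of the load vector). -/
def roomSum (i : ℕ) (hiR L : List ℕ) : ℕ :=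
  roomSumAux (hiR.drop (i - 24)) ((cleft capJ L).drop (2 * (i - 24)))

/-- Feasibility of the window: some invertible count `b'` with `max(b, 7, 23 − a − roomSum) ≤ b' ≤
min(9, b + ic, 23 − a)` must exist (`ic` = remaining invertible capacity). -/
def feas (i b a ic : ℕ) (hiR L : List ℕ) : Bool :=
  Nat.ble (max b (max 7 (23 - a - roomSum i hiR L))) (min 9 (min (b + ic) (23 - a)))

/-- Action of generator `s` on count vectors (as lists of 40 digits): `(actG s v)[b] = v[gsrc s b]`. -/
def actG (s : ℕ) (v : List ℕ) : List ℕ := (gsrcL.getD s []).map fun a => v.getD a 0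

/-- Action of a word (generators applied left to right). -/
def actW : List ℕ → List ℕ → List ℕ
  | [], v => v
  | s :: w, v => actW w (actG s v)

/-- Leaf test: the completed digit list is listed, and its certificate (representative, word) reproduces it. -/
def leafOK : List (List ℕ × ℕ × List ℕ) → List ℕ → Bool
  | [], _ => false
  | (v, j, w) :: rest, p => if v = p then decide (actW w (repcL.getD j []) = p) else leafOK rest p

/-- **The checker.** `chk LO HI hiR certs n i p L b a ic`: at depth `i` (`n = 40 − i` classes left) with assigned
digits `p` (classes `0 … i−1`), load vector `L`, invertible count `b`, rank-one count `a` and remaining invertible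
capacity `ic`: either the window is infeasible, or (at a leaf) the certificate test passes, or (inside) every digit
`d ∈ [LO i, HI i]` that respects all caps leads to a passing subtree. -/
def chk (LO HI hiR : List ℕ) (certs : List (List ℕ × ℕ × List ℕ)) :
    ℕ → ℕ → List ℕ → List ℕ → ℕ → ℕ → ℕ → Bool
  | 0, i, p, L, b, a, ic => !(feas i b a ic hiR L) || leafOK certs p
  | n + 1, i, p, L, b, a, ic => !(feas i b a ic hiR L) ||
      (List.range' (LO.getD i 0) (HI.getD i 0 + 1 - LO.getD i 0)).all fun d =>
        !(leAll (bump L (incL.getD i []) d) capL) ||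
          chk LO HI hiR certs n (i + 1) (p ++ [d]) (bump L (incL.getD i []) d)
            (if i < 24 then b + d else b) (if i < 24 then a else a + d) (if i < 24 then ic - HI.getD i 0 else ic)

/-- The initial (zero) load vector. -/
def load0 : List ℕ := List.replicate 82 0

/-- Sum of the first `n` entries (zero-padded). -/
def sumTo (l : List ℕ) : ℕ → ℕ
  | 0 => 0
  | n + 1 => sumTo l n + l.getD n 0

/-- The whole search of a case: all 40 classes from the root. -/
def runCase (LO HI : List ℕ) (certs : List (List ℕ × ℕ × List ℕ)) : Bool :=
  chk LO HI (HI.drop 24) certs 40 0 [] load0 0 0 (sumTo HI 24)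

open Finset

/-! ### List plumbing -/

/-- Digits of a prefix as a function. -/
def pv (p : List ℕ) (t : ℕ) : ℕ := p.getD t 0

/-- `bump` preserves the length. -/
theorem bump_length : ∀ (L M : List ℕ) (d : ℕ), L.length = M.length → (bump L M d).length = L.length
  | [], [], _, _ => rfl
  | _ :: L, _ :: M, d, h => by
      simp only [bump, List.length_cons, Nat.succ.injEq] at h ⊢; exact bump_length L M d h
  | [], _ :: _, _, h => by simp at h
  | _ :: _, [], _, h => by simp at h

/-- Entries of `bump`: `L[k] + d·M[k]`. -/
theorem bump_getD : ∀ (L M : List ℕ) (d k : ℕ), L.length = M.length →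
    (bump L M d).getD k 0 = L.getD k 0 + d * M.getD k 0
  | [], [], _, _, _ => by simp [bump]
  | l :: L, m :: M, d, k, h => by
      cases k with
      | zero => simp [bump]
      | succ k =>
          simp only [bump, List.getD_cons_succ]
          exact bump_getD L M d k (by simpa using h)
  | [], _ :: _, _, _, h => by simp at h
  | _ :: _, [], _, _, h => by simp at h

/-- `leAll` is the pointwise `≤` test. -/
theorem leAll_iff : ∀ (L M : List ℕ), L.length = M.length →
    (leAll L M = true ↔ ∀ k, k < L.length → L.getD k 0 ≤ M.getD k 0)
  | [], [], _ => by simp [leAll]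
  | l :: L, m :: M, h => by
      simp only [leAll, Bool.and_eq_true, Nat.ble_eq, List.length_cons]
      rw [leAll_iff L M (by simpa using h)]
      constructor
      · rintro ⟨h1, h2⟩ k hk
        cases k with
        | zero => simpa using h1
        | succ k => simp only [List.getD_cons_succ]; exact h2 k (by omega)
      · intro hk
        refine ⟨by simpa using hk 0 (by omega), fun k hk' => ?_⟩
        have := hk (k + 1) (by omega)
        simpa only [List.getD_cons_succ] using this
  | [], _ :: _, h => by simp at h
  | _ :: _, [], h => by simp at h

/-- `roomSumAux` is the sum of the paired minima. -/
theorem roomSumAux_eq : ∀ (H C : List ℕ), 2 * H.length ≤ C.length →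
    roomSumAux H C = ∑ s ∈ range H.length, min (H.getD s 0) (min (C.getD (2 * s) 0) (C.getD (2 * s + 1) 0))
  | [], _, _ => by simp [roomSumAux]
  | h :: H, [], hl => by simp at hl
  | h :: H, [c], hl => by simp at hl; omega
  | h :: H, c₁ :: c₂ :: C, hl => by
      rw [roomSumAux, roomSumAux_eq H C (by simp at hl; omega), List.length_cons, Finset.sum_range_succ']
      simp only [List.getD_cons_zero, List.getD_cons_succ, Nat.mul_zero, Nat.zero_add, Nat.mul_succ]
      rw [add_comm]

/-- Entries of `cleft capJ L` on the J-block. -/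
theorem cleft_getD : ∀ (C L : List ℕ) (k : ℕ), k < C.length → k < L.length →
    (cleft C L).getD k 0 = C.getD k 0 - L.getD k 0
  | [], _, _, h, _ => by simp at h
  | _ :: _, [], _, _, h => by simp at h
  | c :: C, l :: L, 0, _, _ => by simp [cleft]
  | c :: C, l :: L, k + 1, h1, h2 => by
      simp only [cleft, List.getD_cons_succ]
      exact cleft_getD C L k (by simpa using h1) (by simpa using h2)

/-- `cleft` has the length of the cap list. -/
theorem cleft_length : ∀ (C L : List ℕ), L.length ≥ C.length → (cleft C L).length = C.length
  | [], _, _ => by simp [cleft]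
  | _ :: _, [], h => by simp at h
  | c :: C, l :: L, h => by
      simp only [cleft, List.length_cons, Nat.succ.injEq]; exact cleft_length C L (by simpa using h)

/-- `capJ` is the J-block of `capL`. -/
theorem capJ_facts : capJ.length = 32 ∧ ∀ k, k < 32 → capJ.getD k 0 = cap k := by decide

/-- **The linear-pass capacity bound is the sum of the rooms** of the unassigned rank-one classes. -/
theorem roomSum_eq (i : ℕ) (hi : i ≤ 40) (hiR L : List ℕ) (hH : hiR.length = 16) (hL : L.length = 82) :
    roomSum i hiR L = ∑ s ∈ Ico (i - 24) 16, room hiR L s := by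
  have hcl : (cleft capJ L).length = 32 := by rw [cleft_length _ _ (by rw [hL, capJ_facts.1]; omega), capJ_facts.1]
  rw [roomSum, roomSumAux_eq _ _ (by simp [hH, hcl]; omega), List.length_drop, hH, Finset.sum_Ico_eq_sum_range]
  refine Finset.sum_congr rfl fun s hs => ?_
  have hs' := Finset.mem_range.mp hs
  have gd : ∀ (l : List ℕ) (n m : ℕ), (l.drop n).getD m 0 = l.getD (n + m) 0 := fun l n m => by
    simp [List.getD_eq_getElem?_getD]
  rw [room, gd, gd, gd,
    cleft_getD _ _ _ (by rw [capJ_facts.1]; omega) (by rw [hL]; omega),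
    cleft_getD _ _ _ (by rw [capJ_facts.1]; omega) (by rw [hL]; omega),
    capJ_facts.2 _ (by omega), capJ_facts.2 _ (by omega),
    show 2 * (i - 24) + 2 * s = 2 * (i - 24 + s) by ring, show 2 * (i - 24) + (2 * s + 1) = 2 * (i - 24 + s) + 1 by ring]

/-- `sumTo` is the zero-padded partial sum. -/
theorem sumTo_eq (l : List ℕ) : ∀ n, sumTo l n = ∑ t ∈ range n, l.getD t 0
  | 0 => by simp [sumTo]
  | n + 1 => by rw [sumTo, sumTo_eq l n, Finset.sum_range_succ]


end Summit.MatrixMultiplication.OmegaCensus.SmallFormats.Enum723
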